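import Literature.MathematicalPhysics.QuantumFieldTheory.Balaban1983to89.Node00.TorusCoverSUGauge
import Literature.MathematicalPhysics.QuantumFieldTheory.Balaban1983to89.Node00.BoxStaircasePhaseLocal

/-!
# NODE 00 — FILE 3b′: the `U(N) → SU(N)` NORMALISATION OF A UNITARY GAUGE ON A BOX UNDER THE PER-BOND WINDOW — dag-n07-e's FILE 3b
# `exists_suGauge_of_unitaryGauge` with the total-width hypothesis `(2W + 1)·(ηN r₀) < 2π` REPLACED by `4τ < 2π`, `τ` a bound on the per-bond angle
# `η·N·‖A(b)‖`; hence valid on boxes of ANY width — in particular on the whole (1.131) tower `□₀` of a datum with [6] (1.136)'s level-weighted letters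

Cell `pub-ymgap`, width seat `pub-ymgap-dag-n07-w3` generation 7 (sub-target S3 = [15] (145)–(156) at objects; CLAIM-4 ∕ INTENT-4, cell INBOX 2026-08-28).
NEW leaf; CONSUMED BY NAME, nothing modified: dag-n07-e's FILE 3b `Node00.TorusCoverSUGauge` (`det_val_cfgExp`, `trace_eq_re_of_isSelfAdjoint`, `norm_trace_le_card_mul`,
`norm_det_eq_one_of_mem_unitaryUnits`, `smul_mem_specialUnitaryGroup`, `val_cfgExp_traceless`, `traceless`), FILE 3a `Node00.BoxStaircasePhase` (`stairSum`,
`lam_eq_mul_exp_stairSum`), this seat's FILE 3a′ `Node00.BoxStaircasePhaseLocal` (`stairSum_add_e_sub_eq_local` — exactness from plaquette-local flatness).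
`--kind proof --supports stmt-QuantumFields-27364` (K1⁹; count-neutral helper).  [6] = [Balaban1985RegularSpaces]; [3] = [Balaban1985Averaging]; [15] = [Balaban1985Variational].

WHY (LOCATED-LANDAU-REGION, dag-n07-w8 g6; LOCATED-SU-NORMALISATION-BELOW-TOP, this seat — cell INBOX 2026-08-28).  [6] Prop. 6 ∕ [15] (152) give the Landau
potential `A` on the whole (1.131) tower `{□_j}` of a datum with the LEVEL-WEIGHTED bound `‖A(b)‖ ≤ r·(Lʲη)⁻¹` on bonds side-touching `□_j` (tree: `Node00.GaugedBoundB8`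
conjunct 5); the torus doors of this lineage normalise [6]'s `U(N)`-valued gauge to `SU(N)` by FILE 3b, whose exactness step needs `(2W + 1)·(ηN r₀) < 2π` with a
UNIFORM `r₀` over a box of width `W` — met on the top box (`r₀ = r`, `W ≈ Lᵏ·side`, `η = L^{−k}`) and failing on `□_j`, `j < k` (`r₀ = r·L^{k−j}`).  The per-bond
angle, however, is `η·N·‖A(b)‖ ≤ N r L^{−j} ≤ N r` EVERYWHERE on the tower; and FILE 3a′ shows that a per-bond window `4τ < 2π` already makes the staircase
phase exact (the determinant phase of a site function is flat on every plaquette).  THIS FILE re-runs FILE 3b's construction with that exactness: ★★★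
`exists_suGauge_of_unitaryGauge_local` — same data (`V` with `det = 1`, a unitary gauge `g`, `V^{g} = e^{iηA}` with `A` self-adjoint on the box's bonds), hypothesis
`η·N·‖A(b)‖ ≤ τ` per bond with `4τ < 2π`, conclusion `∃ s : ℤᵈ → SU(N)`, `V^{ιSU ∘ s} = cfgExp η (traceless ∘ A)` on every bond of the box.  The width of the box
no longer enters; `A` may obey any position-dependent bound (only the per-bond cap `τ` is used), so the traceless exponent keeps [6]'s weights up to the factor `2`
(`norm_traceless_le`).  Downstream (next files of this lane): the member-side extraction on every `□_j` and the torus push-down on the tower windows.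

WHAT IS PROVED (kernel; `𝔸 = M_N(ℂ)`, `N ≥ 1`; elementary; no definition).  ★★★ `exists_suGauge_of_unitaryGauge_local`; ★ `exists_suGauge_of_unitaryGauge_local'`
(the same with FILE 3b's letter `r₀`: `‖A‖ ≤ r₀` and `4·(ηN r₀) < 2π`).
HONEST FRAMING: elementary; nothing of Bałaban asserted or discharged; no token ∕ stub ∕ K-item closed; N07 ∕ N05 NOT discharged; counts unmoved; one finite 𝕋⁴
programme at fixed ε — R4 closes the conditional finite-𝕋⁴ rung `BalabanLadder.UV` only; the YM mass gap (Clay) is NOT proved by any of this; nothing continuum ∕ ℝ⁴ ∕ OS.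
No `sorry`, no `def`, no `instance`, no `notation`.

References: [Balaban1985RegularSpaces] Prop. 6 (1.135)–(1.138) p.99, (1.131) p.99; [Balaban1985Averaging] (9) p.18, p.20 (G = e^{i𝔤}); [Balaban1985Variational] (152) p.301.
-/

noncomputable section

namespace Literature.MathematicalPhysics.QuantumFieldTheory.Balaban1983to89.Node00

open scoped Matrix.Norms.L2Operator
open Complex (I)
open NormedSpace (exp)
open B7Prop1Explicit (e e_apply expUnit val_expUnit)
open B7Prop1Local (InBox)
open B7Prop2Explicit (unitaryUnits mem_unitaryUnits)
open B7Prop2SpecialUnitary (specialUnitaryUnits mem_specialUnitaryUnits)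
open B8Eq184Proof (cfgExp)

section Matrices

variable {N : ℕ} [NeZero N]

omit [NeZero N] in
/-- The determinant of the inverse unit is the inverse determinant (FILE 3b's private helper, re-stated). [folklore] -/
private theorem det_val_inv_units' (u : (MatA N)ˣ) : ((u⁻¹ : (MatA N)ˣ) : MatA N).det = ((u : MatA N).det)⁻¹ := by
  have h := congrArg Matrix.det u.inv_mul
  rw [Matrix.det_mul, Matrix.det_one] at h
  exact eq_inv_of_mul_eq_one_left h

/-- The box predicate, coordinatewise. [folklore] -/
private theorem inBox_iff_forall' {d : ℕ} (lo hi y : B7Prop1Explicit.Site d) : InBox lo hi y ↔ ∀ i, lo i ≤ y i ∧ y i ≤ hi i := Iff.rfl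

/-- ★★★ **THE `U(N) → SU(N)` NORMALISATION UNDER THE PER-BOND WINDOW** (dag-n07-e's `exists_suGauge_of_unitaryGauge` with the total-width window removed): on a
box `[lo, hi]` of `ℤᵈ`, let `V` have `det V(b) = 1` on the box's bonds, `g` be unitary on the box, `V^{g}(b) = e^{iηA(b)}` with `A(b)` self-adjoint on the box's
bonds, and let the per-bond angle be capped: `η·N·‖A(b)‖ ≤ τ` with `4τ < 2π`.  Then there is `s : ℤᵈ → SU(N)` with `V^{ιSU ∘ s}(b) = e^{iη·traceless(A(b))}` on
every bond of the box.  Proof: FILE 3b's — the determinant phase `λ = det ∘ g` steps by `e^{−iθ(b)}`, `θ = η·Re tr A`, `|θ| ≤ τ`; its staircase integral `Θ` is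
EXACT on every bond by FILE 3a′ (`stairSum_add_e_sub_eq_local`: plaquette-local flatness, per-bond window `4τ < 2π`, NO width condition); `s := (c·e^{iΘ∕N})⁻¹·g`
with `c^N = λ(lo)`. [cite: Balaban1985RegularSpaces, Prop. 6 p.99, (1.136) p.99, (1.131) p.99; Balaban1985Averaging, (9) p.18, p.20; Balaban1985Variational, (152) p.301] -/
theorem exists_suGauge_of_unitaryGauge_local {d : ℕ} (lo hi : B7Prop1Explicit.Site d) {η : ℝ} (hη : 0 ≤ η)
    (V : B7Prop1Explicit.Site d → Fin d → (MatA N)ˣ) (g : B7Prop1Explicit.Site d → (MatA N)ˣ) (A : B7Prop1Explicit.Site d → Fin d → MatA N) {τ : ℝ}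
    (hV : ∀ x μ, InBox lo hi x → InBox lo hi (x + e μ) → ((V x μ : (MatA N)ˣ) : MatA N).det = 1)
    (hg : ∀ x, InBox lo hi x → g x ∈ unitaryUnits (MatA N))
    (hgauge : ∀ x μ, InBox lo hi x → InBox lo hi (x + e μ) → B7Prop1Explicit.gaugeAct g V x μ = cfgExp η A x μ)
    (hsa : ∀ x μ, InBox lo hi x → InBox lo hi (x + e μ) → IsSelfAdjoint (A x μ))
    (hA : ∀ x μ, InBox lo hi x → InBox lo hi (x + e μ) → η * (N * ‖A x μ‖) ≤ τ)
    (hsmall : 4 * τ < 2 * Real.pi) :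
    ∃ s : B7Prop1Explicit.Site d → Matrix.specialUnitaryGroup (Fin N) ℂ, ∀ x μ, InBox lo hi x → InBox lo hi (x + e μ) →
      B7Prop1Explicit.gaugeAct (fun y => ιSU N (s y)) V x μ = cfgExp η (fun y ν => traceless (A y ν)) x μ := by
  classical
  have hNpos : 0 < N := NeZero.pos N
  have hN : (0 : ℝ) < N := Nat.cast_pos.2 hNpos
  -- empty box: nothing to prove
  by_cases hne : InBox lo hi lo
  swap
  · refine ⟨fun _ => 1, fun x μ hx _ => (hne fun i => ⟨le_rfl, (hx i).1.trans (hx i).2⟩).elim⟩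
  -- the per-bond cap is nonnegative (the box has at least the point `lo`; if it has no bond the cap is never used, so we only need `0 ≤ τ` when a bond exists)
  -- the determinant phase and its bond angles
  set lam : B7Prop1Explicit.Site d → ℂ := fun y => ((g y : (MatA N)ˣ) : MatA N).det with hlam
  set θ : B7Prop1Explicit.Site d → Fin d → ℝ := fun y μ => η * ((A y μ).trace).re with hθ
  have hlam1 : ∀ y, InBox lo hi y → ‖lam y‖ = 1 := fun y hy => norm_det_eq_one_of_mem_unitaryUnits (hg y hy)
  have hlam0 : ∀ y, InBox lo hi y → lam y ≠ 0 := fun y hy h => by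
    have := hlam1 y hy; rw [h, norm_zero] at this; exact zero_ne_one this
  -- Liouville: `λ(x+e_μ) = λ(x)·e^{−iθ(b)}`
  have hstep : ∀ y μ, InBox lo hi y → InBox lo hi (y + e μ) → lam (y + e μ) = lam y * Complex.exp (I * ↑(-θ y μ)) := by
    intro y μ hy hy'
    have h1 := congrArg (fun u : (MatA N)ˣ => (u : MatA N).det) (hgauge y μ hy hy')
    simp only [B7Prop1Explicit.gaugeAct, Units.val_mul, Matrix.det_mul, det_val_inv_units', hV y μ hy hy', mul_one,
      det_val_cfgExp] at h1
    rw [trace_eq_re_of_isSelfAdjoint (hsa y μ hy hy')] at h1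
    have h2 : lam y * (lam (y + e μ))⁻¹ = Complex.exp (I * θ y μ) := by
      rw [hθ]; dsimp only; push_cast; rw [← mul_assoc]; exact h1
    have h3 : lam (y + e μ) ≠ 0 := hlam0 _ hy'
    have h4 : lam y ≠ 0 := hlam0 _ hy
    calc lam (y + e μ) = lam y * (lam y * (lam (y + e μ))⁻¹)⁻¹ := by field_simp
      _ = lam y * Complex.exp (I * ↑(-θ y μ)) := by rw [h2, ← Complex.exp_neg]; push_cast; ring_nf
  -- the bond angles are capped: `|θ(b)| ≤ ηN‖A(b)‖ ≤ τ`
  have hτ : ∀ y μ, InBox lo hi y → InBox lo hi (y + e μ) → |(-θ y μ)| ≤ τ := by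
    intro y μ hy hy'
    rw [abs_neg, hθ]
    dsimp only
    rw [abs_mul, abs_of_nonneg hη]
    refine le_trans (mul_le_mul_of_nonneg_left ?_ hη) (hA y μ hy hy')
    calc |((A y μ).trace).re| ≤ ‖(A y μ).trace‖ := Complex.abs_re_le_norm _
      _ ≤ N * ‖A y μ‖ := norm_trace_le_card_mul _
  -- the `N`-th root of the phase: `c^N = λ(lo)`, `μf y = c·e^{iS(y)∕N}`, `S = stairSum (−θ)`
  obtain ⟨c, hc⟩ := IsAlgClosed.exists_pow_nat_eq (lam lo) hNpos
  have hc1 : ‖c‖ = 1 := by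
    have h := congrArg (fun z : ℂ => ‖z‖) hc
    simp only [norm_pow, hlam1 lo hne] at h
    exact (pow_eq_one_iff_of_nonneg (norm_nonneg c) hNpos.ne').1 h
  set S : B7Prop1Explicit.Site d → ℝ := fun y => stairSum lo (fun y μ => -θ y μ) y with hS
  set μf : B7Prop1Explicit.Site d → ℂ := fun y => c * Complex.exp (I * ↑(S y) / N) with hμf
  have hμ1 : ∀ y, ‖μf y‖ = 1 := fun y => by
    rw [hμf]; dsimp only
    rw [norm_mul, hc1, one_mul, show (I * ↑(S y) / N : ℂ) = ↑(S y / N) * I by push_cast; ring, Complex.norm_exp_ofReal_mul_I]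
  have hμN : ∀ y, InBox lo hi y → μf y ^ N = lam y := by
    intro y hy
    rw [hμf]; dsimp only
    have hN' : (N : ℂ) ≠ 0 := by exact_mod_cast hNpos.ne'
    rw [mul_pow, hc, ← Complex.exp_nat_mul, lam_eq_mul_exp_stairSum hy hstep]
    congr 2
    simp only [hS]
    field_simp
  have hμ0 : ∀ y, μf y ≠ 0 := fun y h => by have := hμ1 y; rw [h, norm_zero] at this; exact zero_ne_one this
  -- exactness of the staircase phase on every bond of the box — FILE 3a′, per-bond window, NO width condition
  have hexact : ∀ y μ, InBox lo hi y → InBox lo hi (y + e μ) → S (y + e μ) - S y = -θ y μ := fun y μ hy hy' =>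
    stairSum_add_e_sub_eq_local hy hy' hstep hlam0 hτ hsmall
  -- the `SU(N)`-valued gauge
  have hmem : ∀ y, InBox lo hi y → (μf y)⁻¹ • ((g y : (MatA N)ˣ) : MatA N) ∈ Matrix.specialUnitaryGroup (Fin N) ℂ := fun y hy =>
    smul_mem_specialUnitaryGroup (hμ1 y) (mem_unitaryUnits.1 (hg y hy)) (hμN y hy)
  let s : B7Prop1Explicit.Site d → Matrix.specialUnitaryGroup (Fin N) ℂ := fun y =>
    if h : ∀ i, lo i ≤ y i ∧ y i ≤ hi i then ⟨(μf y)⁻¹ • ((g y : (MatA N)ˣ) : MatA N), hmem y h⟩ else 1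
  have hs : ∀ y, InBox lo hi y → ((ιSU N (s y) : (MatA N)ˣ) : MatA N) = (μf y)⁻¹ • ((g y : (MatA N)ˣ) : MatA N) := by
    intro y hy
    rw [coe_ιSU]
    simp only [s, dif_pos ((inBox_iff_forall' lo hi y).1 hy)]
  have hsinv : ∀ y, InBox lo hi y → (((ιSU N (s y))⁻¹ : (MatA N)ˣ) : MatA N) = (μf y) • (((g y)⁻¹ : (MatA N)ˣ) : MatA N) := by
    intro y hy
    refine Units.inv_eq_of_mul_eq_one_right ?_
    rw [hs y hy, Matrix.smul_mul, Matrix.mul_smul, smul_smul, Units.mul_inv, inv_mul_cancel₀ (hμ0 y), one_smul]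
  refine ⟨s, fun x μ hx hx' => ?_⟩
  apply Units.ext
  have hval := congrArg (fun u : (MatA N)ˣ => (u : MatA N)) (hgauge x μ hx hx')
  simp only [B7Prop1Explicit.gaugeAct, Units.val_mul] at hval ⊢
  rw [hs x hx, hsinv (x + e μ) hx', Matrix.smul_mul, Matrix.smul_mul, Matrix.mul_smul, smul_smul, hval]
  -- `μ(x)⁻¹·μ(x+e_μ) = e^{−iθ∕N}`
  have hratio : (μf x)⁻¹ * μf (x + e μ) = Complex.exp (-(I * ↑(η * ((A x μ).trace).re) / N)) := by
    have hc0 : c ≠ 0 := fun h => by rw [h, norm_zero] at hc1; exact zero_ne_one hc1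
    have h1 : (μf x)⁻¹ * μf (x + e μ) = Complex.exp (I * ↑(S (x + e μ)) / N - I * ↑(S x) / N) := by
      rw [Complex.exp_sub, hμf]
      dsimp only
      have he : Complex.exp (I * ↑(S x) / N) ≠ 0 := Complex.exp_ne_zero _
      field_simp
    rw [h1]
    congr 1
    have h2 : ((S (x + e μ) : ℝ) : ℂ) - ↑(S x) = -↑(θ x μ) := by
      rw [← Complex.ofReal_sub, hexact x μ hx hx']; push_cast; rfl
    calc I * ↑(S (x + e μ)) / ↑N - I * ↑(S x) / ↑N = I * (↑(S (x + e μ)) - ↑(S x)) / N := by ring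
      _ = -(I * ↑(η * ((A x μ).trace).re) / N) := by rw [h2, hθ]; ring
  rw [hratio, val_cfgExp_traceless]

/-- ★ **THE SAME IN FILE 3b's LETTER `r₀`**: `‖A(b)‖ ≤ r₀` on the box's bonds and `4·(ηN r₀) < 2π` (FILE 3b's statement with `(2W + 1)` replaced by `4`).
[cite: Balaban1985RegularSpaces, Prop. 6 p.99, (1.136) p.99; Balaban1985Averaging, (9) p.18, p.20] -/
theorem exists_suGauge_of_unitaryGauge_local' {d : ℕ} (lo hi : B7Prop1Explicit.Site d) {η : ℝ} (hη : 0 ≤ η)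
    (V : B7Prop1Explicit.Site d → Fin d → (MatA N)ˣ) (g : B7Prop1Explicit.Site d → (MatA N)ˣ) (A : B7Prop1Explicit.Site d → Fin d → MatA N) {r₀ : ℝ}
    (hV : ∀ x μ, InBox lo hi x → InBox lo hi (x + e μ) → ((V x μ : (MatA N)ˣ) : MatA N).det = 1)
    (hg : ∀ x, InBox lo hi x → g x ∈ unitaryUnits (MatA N))
    (hgauge : ∀ x μ, InBox lo hi x → InBox lo hi (x + e μ) → B7Prop1Explicit.gaugeAct g V x μ = cfgExp η A x μ)
    (hsa : ∀ x μ, InBox lo hi x → InBox lo hi (x + e μ) → IsSelfAdjoint (A x μ))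
    (hA : ∀ x μ, InBox lo hi x → InBox lo hi (x + e μ) → ‖A x μ‖ ≤ r₀)
    (hsmall : 4 * (η * N * r₀) < 2 * Real.pi) :
    ∃ s : B7Prop1Explicit.Site d → Matrix.specialUnitaryGroup (Fin N) ℂ, ∀ x μ, InBox lo hi x → InBox lo hi (x + e μ) →
      B7Prop1Explicit.gaugeAct (fun y => ιSU N (s y)) V x μ = cfgExp η (fun y ν => traceless (A y ν)) x μ := by
  have hN : (0 : ℝ) ≤ N := Nat.cast_nonneg N
  refine exists_suGauge_of_unitaryGauge_local lo hi hη V g A hV hg hgauge hsa (τ := η * N * r₀) (fun x μ hx hx' => ?_) hsmall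
  calc η * (N * ‖A x μ‖) ≤ η * (N * r₀) := mul_le_mul_of_nonneg_left (mul_le_mul_of_nonneg_left (hA x μ hx hx') hN) hη
    _ = η * N * r₀ := by ring

end Matrices

end Literature.MathematicalPhysics.QuantumFieldTheory.Balaban1983to89.Node00

end
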